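import Literature.AlgebraicGeometry.Resolution.AlterationsGraphClosure
import Literature.AlgebraicGeometry.Resolution.AlterationsSemiStableCodimTwoProofs
import Literature.AlgebraicGeometry.Resolution.FlatSlicingCriterion
import Literature.AlgebraicGeometry.Resolution.LiuFlatIntegral
import Literature.AlgebraicGeometry.Resolution.RegularLocalRingsNormal
import Literature.AlgebraicGeometry.Resolution.SmoothStalksRegular
import Literature.AlgebraicGeometry.Resolution.StalkSpecializesLocalization
import Mathlib.RingTheory.DiscreteValuationRing.TFAE
import Mathlib.RingTheory.Ideal.AssociatedPrime.Finiteness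
import Mathlib.RingTheory.Regular.Flat
import HarnessLib

/-!
# De Jong 1996, 4.21: a semi-stable curve over a normal base with smooth generic fibre is
# normal — PROOF of the named fact `DeJong1996SemiStableCurveNormal`

Topic: `Literature/AlgebraicGeometry/Resolution`. Proof file for `AlterationsGraphClosure.lean`,
discharging its named fact `DeJong1996SemiStableCurveNormal` (de Jong 1996, 4.21, p. 74):

> "We remark that `𝒞` is a normal scheme: it is flat over a normal excellent scheme, with
> reduced fibres of dimension 1, hence condition S₂ is fullfilled; the smooth locus of `𝒞 → S`
> is dense in all fibres and the generic fibre is smooth, hence `𝒞` is regular in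
> codimension 1; apply the criterium of Serre (S₂ + R₁ ⇒ normal)."

rendered (unchanged): for a semi-stable curve `p : 𝒞 → S` (`IsSemiStableCurve`, 2.21) over an
integral Noetherian scheme `S` with integrally closed local rings and with smooth generic fibre,
every local ring `𝒪_{𝒞,c}` is integrally closed (`DeJong1996SemiStableCurveNormal_holds`).

Serre's criterion and the depth formalism are not available in Mathlib; the proof given here
runs the same two ingredients (`R₁` from the smooth generic fibre, `S₂` from flatness over the
normal base with reduced fibres) through the following direct argument, which only ever needs
depth *one*. `𝒞` is integral (Liu 2002, Prop. 4.3.8: flat over the integral `S` with integral —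
smooth and connected — generic fibre; `isIntegral_of_isSemiStableCurve`). Let `b/a ∈ K(𝒞)` be
integral over `B = 𝒪_{𝒞,c}` with `b ∉ aB`. An associated prime `P ⊇ (aB : b)` of `B/aB`,
`P = (aB : y)`, is the prime of a generization `c' ⤳ c` with `𝒪_{𝒞,c'} = B_P`
(`StalkSpecializesLocalization.lean`), and there `y ∉ aB_P`, `𝔪_{c'} y ⊆ aB_P`: the local ring
`𝒪_{𝒞,c'}` "has depth one". The **key lemma** `isIntegrallyClosed_stalk_of_depthOne_witness`
shows that such a local ring is integrally closed (indeed regular): with the flat local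
homomorphism `A = 𝒪_{S,s} → B' = 𝒪_{𝒞,c'}` and the reduced fibre ring `F = B'/𝔪_A B'`
(2.21, `Motives/FiberStalk.lean`),
* over the generic point, `B'` is a local ring of the smooth generic fibre, hence regular
  (Stacks 056S, `SmoothStalksRegular.lean`) — this is `R₁`;
* otherwise pick `0 ≠ a₁ ∈ 𝔪_A` and move the witness to `a₁` (`depthOne_transfer`); if `F` is
  not a field, its maximal ideal contains an `F`-regular `t ∈ 𝔪_{B'}` (`F` is reduced;
  `exists_mem_maximalIdeal_isSMulRegular`), which stays regular on `B'/a₁B'` by Matsumura's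
  Corollary to Thm. 22.5 (`FlatSlicingCriterion.lean`) — contradicting `ty ∈ a₁B'`; if `F` is
  a field, `𝔪_{B'} = 𝔪_A B'`, the witness descends to `A/a₁A` along the flat `A → B'`
  (`exists_depthOne_witness_base`: a regular `A`-sequence `a₁, t` stays regular on `B'`, and
  prime avoidance over `Ass(A/a₁A)`), the normal `A` is then a discrete valuation ring
  (`isRegularLocalRing_of_depthOne_witness` — the depth-one case of "normal ⇒ S₂"), and `B'` is
  regular by Matsumura 23.7 (ii) (`IsRegularLocalRing.of_flat_of_isField_quotient`).
So `b/a ∈ B_P` (regular local rings are normal, Matsumura 19.4, `RegularLocalRingsNormal.lean`),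
i.e. `ub ∈ aB` for some `u ∉ P` — contradicting `(aB : b) ⊆ P`.

## Sources

* A. J. de Jong, *Smoothness, semi-stability and alterations*, Publ. Math. IHÉS 83 (1996), 2.21
  (p. 61), 4.21 (p. 74). [DeJong1996]
* H. Matsumura, *Commutative Ring Theory* (1986), Thm. 19.4, §22 Cor. to Thm. 22.5, Thm. 23.7;
  (for comparison) Thm. 23.8 (Serre's criterion) and Cor. to Thm. 23.9. [Matsumura1987]
* Q. Liu, *Algebraic Geometry and Arithmetic Curves* (2002), Prop. 4.3.8; cf. Lemma 4.1.18 (the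
  same statement over a discrete valuation ring). [Liu2002]
* The Stacks Project, Tags 056S, 01J7, 00LD (prime avoidance over associated primes).
-/

noncomputable section

open CategoryTheory CategoryTheory.Limits AlgebraicGeometry TopologicalSpace IsLocalRing Pointwise

namespace Literature.AlgebraicGeometry.Resolution

universe u

namespace DeJong1996SemiStableCurveNormalProof

/-! ## Commutative algebra: depth-one witnesses -/

/-- Transfer of a "depth one" witness between non-zero-divisors: in a domain `B`, if `y ∉ aB`
with `𝔪y ⊆ aB` and `a₁ ∈ 𝔪` is non-zero, then `z = a₁y/a` satisfies `z ∉ a₁B`, `𝔪z ⊆ a₁B`.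
[folklore] -/
theorem depthOne_transfer {B : Type*} [CommRing B] [IsDomain B] (m : Ideal B) {a a₁ y : B}
    (ha : a ≠ 0) (ha₁ : a₁ ≠ 0) (ha₁m : a₁ ∈ m) (hy : y ∉ Ideal.span {a})
    (hmy : ∀ t ∈ m, t * y ∈ Ideal.span {a}) :
    ∃ z : B, z ∉ Ideal.span {a₁} ∧ ∀ t ∈ m, t * z ∈ Ideal.span {a₁} := by
  obtain ⟨z, hz⟩ := Ideal.mem_span_singleton'.mp (hmy a₁ ha₁m)
  refine ⟨z, fun hzmem => ?_, fun t ht => ?_⟩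
  · obtain ⟨w, hw⟩ := Ideal.mem_span_singleton'.mp hzmem
    apply hy
    refine Ideal.mem_span_singleton'.mpr ⟨w, ?_⟩
    apply mul_left_cancel₀ ha₁
    calc a₁ * (w * a) = (w * a₁) * a := by ring
      _ = z * a := by rw [hw]
      _ = a₁ * y := hz
  · obtain ⟨v, hv⟩ := Ideal.mem_span_singleton'.mp (hmy t ht)
    refine Ideal.mem_span_singleton'.mpr ⟨v, ?_⟩
    apply mul_left_cancel₀ ha
    calc a * (v * a₁) = (v * a) * a₁ := by ring
      _ = t * y * a₁ := by rw [hv]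
      _ = t * (a₁ * y) := by ring
      _ = t * (z * a) := by rw [hz]
      _ = a * (t * z) := by ring

/-- In a reduced Noetherian local ring which is not a field, the maximal ideal contains a
non-zero-divisor: otherwise `𝔪` consists of zero-divisors, hence (prime avoidance over the
finitely many associated primes) `𝔪 = Ann(u)` for some `u ≠ 0`; `u` is a unit (else `u² = 0`),
so `𝔪 = 0`. [folklore] -/
theorem exists_mem_maximalIdeal_isSMulRegular {F : Type*} [CommRing F] [IsNoetherianRing F]
    [IsLocalRing F] [IsReduced F] (hF : ¬ IsField F) :
    ∃ t ∈ maximalIdeal F, IsSMulRegular F t := by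
  by_contra hcon
  push Not at hcon
  have hsub : ((maximalIdeal F : Set F)) ⊆ ⋃ P ∈ associatedPrimes F F, (P : Set F) := by
    rw [biUnion_associatedPrimes_eq_zero_divisors]
    intro t ht
    have h := hcon t ht
    rw [isSMulRegular_iff_right_eq_zero_of_smul] at h
    push Not at h
    obtain ⟨x, hx, hx0⟩ := h
    exact ⟨x, hx0, hx⟩
  haveI := IsLocalRing.maximalIdeal.isMaximal F
  have hmem : maximalIdeal F ∈ associatedPrimes F F :=
    (Ideal.subset_iUnion_iff_mem_of_isMaximal_of_finite (associatedPrimes.finite F F) ⊥ ⊥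
      (fun I hI _ _ => hI.isPrime) bot_ne_top bot_ne_top).mp hsub
  rw [AssociatedPrimes.mem_iff, isAssociatedPrime_iff] at hmem
  obtain ⟨-, u, hu⟩ := hmem
  have hu0 : u ≠ 0 := by
    rintro rfl
    apply (IsLocalRing.maximalIdeal.isMaximal F).ne_top
    rw [hu, eq_top_iff]
    intro r _
    rw [Submodule.mem_colon_singleton, smul_zero]
    exact Submodule.zero_mem _
  have huunit : IsUnit u := by
    by_contra hnu
    have hum : u ∈ maximalIdeal F := hnu
    rw [hu, Submodule.mem_colon_singleton, Submodule.mem_bot, smul_eq_mul] at hum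
    exact hu0 (IsReduced.eq_zero u ⟨2, by rw [pow_two]; exact hum⟩)
  apply hF
  rw [IsLocalRing.isField_iff_maximalIdeal_eq, eq_bot_iff]
  intro r hr
  rw [hu, Submodule.mem_colon_singleton, Submodule.mem_bot, smul_eq_mul] at hr
  exact (Submodule.mem_bot F).mpr (huunit.mul_left_eq_zero.mp hr)

/-- Membership in `r • ⊤ ⊆ A` is membership in the principal ideal `(r)`. [folklore] -/
theorem mem_pointwise_smul_top_iff {A : Type*} [CommRing A] (r x : A) :
    x ∈ r • (⊤ : Submodule A A) ↔ x ∈ Ideal.span {r} := by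
  rw [← Submodule.ideal_span_singleton_smul, smul_eq_mul, Ideal.mul_top]

/-- **Descent of a depth-one witness along a flat local homomorphism with trivial residue
extension of maximal ideals.** Let `A → B` be a local homomorphism of local rings, `A`
Noetherian, `B` flat over `A`, `a₁ ∈ A` a non-zero-divisor, and `z ∈ B` with `z ∉ a₁B` but
`𝔪_A z ⊆ a₁B`. Then `𝔪_A` is an associated prime of `A/a₁A`: there is `w ∉ a₁A` with
`𝔪_A w ⊆ a₁A`. (If some `t ∈ 𝔪_A` were `A/a₁A`-regular, the `A`-sequence `a₁, t` would stay
regular on the flat `B`, contradicting `tz ∈ a₁B`; so `𝔪_A` consists of zero-divisors on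
`A/a₁A` and prime avoidance applies.) [folklore] -/
theorem exists_depthOne_witness_base {A B : Type*} [CommRing A] [CommRing B] [Algebra A B]
    [IsNoetherianRing A] [IsLocalRing A] [Module.Flat A B]
    {a₁ : A} (ha₁ : IsSMulRegular A a₁) {z : B} (hz : z ∉ Ideal.span {algebraMap A B a₁})
    (hmz : ∀ t ∈ maximalIdeal A, algebraMap A B t * z ∈ Ideal.span {algebraMap A B a₁}) :
    ∃ w : A, w ∉ Ideal.span {a₁} ∧ ∀ g ∈ maximalIdeal A, g * w ∈ Ideal.span {a₁} := by
  classical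
  set N := QuotSMulTop a₁ A with hN
  -- every `t ∈ 𝔪_A` is a zero-divisor on `N = A/a₁A`
  have hzd : ∀ t ∈ maximalIdeal A, ∃ n : N, n ≠ 0 ∧ t • n = 0 := by
    intro t ht
    by_contra hcon
    push Not at hcon
    have htreg : IsSMulRegular N t :=
      isSMulRegular_iff_right_eq_zero_of_smul.mpr fun n hn => by
        by_contra h
        exact hcon n h hn
    have hseq : RingTheory.Sequence.IsWeaklyRegular A [a₁, t] := by
      rw [RingTheory.Sequence.isWeaklyRegular_cons_iff,
        RingTheory.Sequence.isWeaklyRegular_cons_iff]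
      exact ⟨ha₁, htreg, RingTheory.Sequence.IsWeaklyRegular.nil _ _⟩
    have hB := hseq.of_flat (S := B)
    simp only [List.map_cons, List.map_nil, RingTheory.Sequence.isWeaklyRegular_cons_iff] at hB
    obtain ⟨-, hBt, -⟩ := hB
    have h0 : (Submodule.Quotient.mk z : QuotSMulTop (algebraMap A B a₁) B) = 0 := by
      refine hBt.right_eq_zero_of_smul ?_
      rw [← Submodule.Quotient.mk_smul, Submodule.Quotient.mk_eq_zero, Algebra.smul_def,
        mem_pointwise_smul_top_iff]
      exact hmz t ht
    rw [Submodule.Quotient.mk_eq_zero, mem_pointwise_smul_top_iff] at h0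
    exact hz h0
  -- hence `𝔪_A` is an associated prime of `N`
  have hsub : ((maximalIdeal A : Set A)) ⊆ ⋃ P ∈ associatedPrimes A N, (P : Set A) := by
    rw [biUnion_associatedPrimes_eq_zero_divisors]
    intro t ht
    exact hzd t ht
  haveI := IsLocalRing.maximalIdeal.isMaximal A
  have hmem : maximalIdeal A ∈ associatedPrimes A N :=
    (Ideal.subset_iUnion_iff_mem_of_isMaximal_of_finite (associatedPrimes.finite A N) ⊥ ⊥
      (fun I hI _ _ => hI.isPrime) bot_ne_top bot_ne_top).mp hsub
  rw [AssociatedPrimes.mem_iff, isAssociatedPrime_iff] at hmem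
  obtain ⟨-, n, hn⟩ := hmem
  obtain ⟨w, rfl⟩ := Submodule.Quotient.mk_surjective _ n
  refine ⟨w, fun hw => ?_, fun g hg => ?_⟩
  · apply (IsLocalRing.maximalIdeal.isMaximal A).ne_top
    rw [hn, eq_top_iff]
    intro r _
    have h0 : (Submodule.Quotient.mk w : N) = 0 := by
      rw [Submodule.Quotient.mk_eq_zero, mem_pointwise_smul_top_iff]
      exact hw
    rw [Submodule.mem_colon_singleton, h0, smul_zero]
    exact Submodule.zero_mem _
  · have h1 : g ∈ (⊥ : Submodule A N).colon {Submodule.Quotient.mk w} := hn ▸ hg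
    rw [Submodule.mem_colon_singleton, Submodule.mem_bot, ← Submodule.Quotient.mk_smul,
      Submodule.Quotient.mk_eq_zero, mem_pointwise_smul_top_iff, smul_eq_mul] at h1
    exact h1

/-- **"Normal implies `S₂`" at a depth-one witness**: a Noetherian local integrally closed
domain `A` with `a₁ ≠ 0`, `w ∉ a₁A` and `𝔪_A w ⊆ a₁A` is regular (indeed a discrete valuation
ring): either `(w/a₁)𝔪 ⊆ 𝔪`, and then `w/a₁` is integral over `A`, hence in `A` — impossible —,
or `g₀ w = a₁ u` for some `g₀ ∈ 𝔪` and a unit `u`, and then `𝔪 = (g₀)`. [folklore] -/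
theorem isRegularLocalRing_of_depthOne_witness {A : Type*} [CommRing A] [IsDomain A]
    [IsNoetherianRing A] [IsLocalRing A] (hA : IsIntegrallyClosed A) {a₁ w : A} (ha₁ : a₁ ≠ 0)
    (hw : w ∉ Ideal.span {a₁}) (hmw : ∀ g ∈ maximalIdeal A, g * w ∈ Ideal.span {a₁}) :
    IsRegularLocalRing A := by
  classical
  have ha₁m : a₁ ∈ maximalIdeal A := by
    intro hunit
    apply hw
    rw [Ideal.span_singleton_eq_top.mpr hunit]
    trivial
  have hprinc : (maximalIdeal A).IsPrincipal := by
    by_cases hcase : ∀ g ∈ maximalIdeal A, ∀ e : A, e * a₁ = g * w → e ∈ maximalIdeal A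
    · -- `w/a₁` stabilises `𝔪`, hence is integral, hence in `A`: contradiction
      exfalso
      let K := FractionRing A
      have ha₁K : algebraMap A K a₁ ≠ 0 :=
        fun h => ha₁ (IsFractionRing.injective A K (by rw [h, map_zero]))
      set x : K := algebraMap A K w / algebraMap A K a₁ with hx
      have hint : IsIntegral A x := by
        let N : Submodule A K := Submodule.map (Algebra.linearMap A K) (maximalIdeal A)
        refine isIntegral_of_smul_mem_submodule N ?_ ?_ x ?_
        · intro hN
          have : algebraMap A K a₁ ∈ N := Submodule.mem_map.mpr ⟨a₁, ha₁m, rfl⟩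
          rw [hN, Submodule.mem_bot] at this
          exact ha₁K this
        · exact (IsNoetherian.noetherian _).map _
        · intro n hn
          obtain ⟨g, hg, rfl⟩ := Submodule.mem_map.mp hn
          obtain ⟨e, he⟩ := Ideal.mem_span_singleton'.mp (hmw g hg)
          have hem := hcase g hg e he
          refine Submodule.mem_map.mpr ⟨e, hem, ?_⟩
          change algebraMap A K e = x • algebraMap A K g
          rw [hx, smul_eq_mul, div_mul_eq_mul_div, eq_div_iff ha₁K, ← map_mul, ← map_mul, he,
            mul_comm]
      obtain ⟨v, hv⟩ := IsIntegrallyClosed.algebraMap_eq_of_integral hint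
      apply hw
      refine Ideal.mem_span_singleton'.mpr ⟨v, ?_⟩
      apply IsFractionRing.injective A K
      rw [map_mul, hv, hx, div_mul_cancel₀ _ ha₁K]
    · push Not at hcase
      obtain ⟨g₀, hg₀, u, hu, hum⟩ := hcase
      have huunit : IsUnit u := by
        by_contra h
        exact hum h
      refine ⟨⟨g₀, le_antisymm ?_ ?_⟩⟩
      · intro g hg
        obtain ⟨e, he⟩ := Ideal.mem_span_singleton'.mp (hmw g hg)
        have h1 : g * u = g₀ * e := by
          apply mul_right_cancel₀ ha₁
          calc g * u * a₁ = g * (u * a₁) := by ring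
            _ = g * (g₀ * w) := by rw [hu]
            _ = g₀ * (g * w) := by ring
            _ = g₀ * (e * a₁) := by rw [he]
            _ = g₀ * e * a₁ := by ring
        refine Ideal.mem_span_singleton'.mpr ⟨e * ↑(huunit.unit⁻¹), ?_⟩
        calc e * ↑huunit.unit⁻¹ * g₀ = (g₀ * e) * ↑huunit.unit⁻¹ := by ring
          _ = g * u * ↑huunit.unit⁻¹ := by rw [h1]
          _ = g := by rw [mul_assoc, IsUnit.mul_val_inv, mul_one]
      · change Ideal.span {g₀} ≤ maximalIdeal A
        rw [Ideal.span_singleton_le_iff_mem]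
        exact hg₀
  haveI : IsPrincipalIdealRing A :=
    ((tfae_of_isNoetherianRing_of_isLocalRing_of_isDomain A).out 4 0).mp hprinc
  infer_instance

/-! ## Points of the base: generic point versus field stalks -/

/-- On an integral scheme, a point whose local ring is a field is the generic point; so at a
point other than the generic point the maximal ideal of the local ring is non-zero.
[folklore] -/
theorem maximalIdeal_stalk_ne_bot_of_ne_genericPoint {S : Scheme.{u}} [IsIntegral S] {s : S}
    (hs : s ≠ genericPoint S) : maximalIdeal (S.presheaf.stalk s) ≠ ⊥ := by
  intro hbot
  apply hs
  have hspec : genericPoint S ⤳ s := (genericPoint_spec S).specializes (Set.mem_univ s)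
  have hmem : genericPoint S ∈ Set.range (S.fromSpecStalk s) := by
    rw [Scheme.range_fromSpecStalk]
    exact hspec
  obtain ⟨q, hq⟩ := hmem
  have hq' : q = IsLocalRing.closedPoint (S.presheaf.stalk s) := by
    apply PrimeSpectrum.ext
    have h1 : q.asIdeal ≤ maximalIdeal _ := IsLocalRing.le_maximalIdeal q.isPrime.ne_top
    rw [hbot, le_bot_iff] at h1
    rw [h1]
    exact hbot.symm
  rw [← hq, hq', Scheme.fromSpecStalk_closedPoint]

/-! ## The local rings at points of the generic fibre are regular -/

/-- **`R₁` over the generic point**: if the generic fibre of `p : 𝒞 → S` (`S` integral) is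
smooth over `κ(η)`, the local ring of `𝒞` at a point `c` over `η` is regular — it is the local
ring of the generic fibre at `c` (`𝒪_{𝒞_η,c} = 𝒪_{𝒞,c}/𝔪_η𝒪_{𝒞,c}`, `𝔪_η = 0`), and schemes
smooth over a field are regular (Stacks 056S). [cite: DeJong1996, 4.21, p. 74] -/
theorem isRegularLocalRing_stalk_of_eq_genericPoint {C S : Scheme.{u}} [IsIntegral S] (p : C ⟶ S)
    (hη : Smooth (p.fiberToSpecResidueField (genericPoint S))) {c : C}
    (hc : p c = genericPoint S) : IsRegularLocalRing (C.presheaf.stalk c) := by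
  have hsm : Smooth (p.fiberToSpecResidueField (p c)) := by rw [hc]; exact hη
  have hreg := @isRegularLocalRing_stalk_of_smooth_of_field _ _ _
    (p.fiberToSpecResidueField (p c)) hsm (p.asFiber c)
  obtain ⟨e⟩ := Literature.AlgebraicGeometry.Motives.nonempty_stalkFiber_ringEquiv_asFiber p c
  have hfield : IsField (S.presheaf.stalk (p c)) := by
    rw [hc]
    exact Field.toIsField S.functionField
  have hbot : (maximalIdeal (S.presheaf.stalk (p c))).map (p.stalkMap c).hom = ⊥ := by
    rw [IsLocalRing.isField_iff_maximalIdeal_eq.mp hfield, Ideal.map_bot]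
  haveI := hreg
  exact IsRegularLocalRing.of_ringEquiv
    (e.trans ((Ideal.quotEquivOfEq hbot).trans (RingEquiv.quotientBot _)))

/-! ## Semi-stable curves: reduced fibre rings, connected fibres, integral total space -/

variable {C S : Scheme.{u}} {p : C ⟶ S}

/-- **The fibre rings `𝒪_{𝒞,c}/𝔪_s𝒪_{𝒞,c}` of a semi-stable curve are reduced**: they are the
local rings of the scheme-theoretic fibres (2.21: reduced). [cite: DeJong1996, 2.21, p. 61] -/
theorem isReduced_fibreRing (hp : IsSemiStableCurve p) (c : C) :
    IsReduced (C.presheaf.stalk c ⧸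
      (maximalIdeal (S.presheaf.stalk (p c))).map (p.stalkMap c).hom) := by
  haveI := hp.isReduced_fiber (p c)
  obtain ⟨e⟩ := Literature.AlgebraicGeometry.Motives.nonempty_stalkFiber_ringEquiv_asFiber p c
  exact isReduced_of_injective e.symm e.symm.injective

/-- **The fibres of a semi-stable curve over field-valued points are connected**: for a field
`K` and `s : Spec K → S`, `𝒞 ×_S Spec K` is connected — its base change to an algebraic
closure is a geometric fibre (2.21: connected) mapping onto it. [cite: DeJong1996, 2.21, p. 61] -/
theorem _root_.Literature.AlgebraicGeometry.Resolution.IsSemiStableCurve.connectedSpace_pullback_of_field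
    (hp : IsSemiStableCurve p) (K : Type u) [Field K] (s : Spec (.of K) ⟶ S) :
    ConnectedSpace ↥(pullback p s) := by
  let Kbar : Type u := AlgebraicClosure K
  let ι : Spec (.of Kbar) ⟶ Spec (.of K) := Spec.map (CommRingCat.ofHom (algebraMap K Kbar))
  haveI : ConnectedSpace ↥(pullback p (ι ≫ s)) := hp.connectedSpace_pullback Kbar _
  let e := pullbackLeftPullbackSndIso p s ι
  haveI : ConnectedSpace ↥(pullback (pullback.snd p s) ι) :=
    (Scheme.homeoOfIso e.symm).surjective.connectedSpace (Scheme.homeoOfIso e.symm).continuous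
  haveI : Subsingleton ↥(Spec (CommRingCat.of K)) :=
    inferInstanceAs (Subsingleton (PrimeSpectrum K))
  haveI : Surjective ι :=
    ⟨fun x => ⟨(⟨⊥, Ideal.isPrime_bot⟩ : PrimeSpectrum Kbar), Subsingleton.elim _ _⟩⟩
  exact (pullback.fst (pullback.snd p s) ι).surjective.connectedSpace
    (pullback.fst (pullback.snd p s) ι).continuous

/-- **The generic fibre of a semi-stable curve with smooth generic fibre is integral**: smooth
over `κ(η)`, so locally Noetherian with integral local rings and reduced (Stacks 056S), and
connected, hence irreducible (Görtz–Wedhorn I, Ex. 3.16). [folklore] -/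
theorem isIntegral_fiber_genericPoint [IsIntegral S] (hp : IsSemiStableCurve p)
    (hη : Smooth (p.fiberToSpecResidueField (genericPoint S))) :
    IsIntegral (p.fiber (genericPoint S)) := by
  haveI := hη
  haveI : ConnectedSpace ↥(p.fiber (genericPoint S)) :=
    hp.connectedSpace_pullback_of_field _ (S.fromSpecResidueField (genericPoint S))
  haveI : IsLocallyNoetherian (p.fiber (genericPoint S)) :=
    LocallyOfFiniteType.isLocallyNoetherian (p.fiberToSpecResidueField (genericPoint S))
  haveI : IrreducibleSpace ↥(p.fiber (genericPoint S)) :=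
    Literature.AlgebraicGeometry.Motives.irreducibleSpace_of_isDomain_stalk _ fun z =>
      @isDomain_stalk_of_smooth _ _ _ (p.fiberToSpecResidueField (genericPoint S)) hη z
  haveI : IsReduced (p.fiber (genericPoint S)) :=
    @isReduced_of_smooth _ _ _ (p.fiberToSpecResidueField (genericPoint S)) hη
  exact isIntegral_of_irreducibleSpace_of_isReduced _

/-- **A semi-stable curve over an integral base with smooth generic fibre is integral** (Liu
2002, Prop. 4.3.8: flat over integral with integral generic fibre). [cite: Liu2002, Prop. 4.3.8] -/
theorem isIntegral_of_isSemiStableCurve [IsIntegral S] (hp : IsSemiStableCurve p)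
    (hη : Smooth (p.fiberToSpecResidueField (genericPoint S))) : IsIntegral C :=
  haveI := hp.flat
  Liu2002IntegralOfFlat_holds C S p (isIntegral_fiber_genericPoint hp hη)

/-! ## The key lemma: a local ring of `𝒞` of depth one is regular -/

/-- **Key lemma.** Let `p : 𝒞 → S` be a semi-stable curve over an integral Noetherian normal
scheme `S` with smooth generic fibre, `𝒞` integral, `c ∈ 𝒞`, and suppose `𝒪_{𝒞,c}` "has depth
one": there are `a ≠ 0` and `y ∉ a𝒪_{𝒞,c}` with `𝔪_c y ⊆ a𝒪_{𝒞,c}`. Then `𝒪_{𝒞,c}` is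
integrally closed (indeed regular of dimension `≤ 1`). With `A = 𝒪_{S,p(c)} → B = 𝒪_{𝒞,c}`
(flat, local) and the reduced fibre ring `F = B/𝔪_A B`: over the generic point `B` is a local
ring of the smooth generic fibre (`R₁`); otherwise pick `0 ≠ a₁ ∈ 𝔪_A` and transfer the witness
to `a₁`; if `F` is not a field, some `t ∈ 𝔪_B` is `F`-regular, hence `B/a₁B`-regular
(Matsumura, Cor. to 22.5) — absurd; if `F` is a field, `𝔪_B = 𝔪_A B`, the witness descends to
`A/a₁A` by flatness, the normal `A` is then a discrete valuation ring, and `B` is regular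
(Matsumura 23.7). This replaces the appeal to Serre's criterion in the printed text.
[cite: DeJong1996, 4.21, p. 74] -/
theorem isIntegrallyClosed_stalk_of_depthOne_witness [IsIntegral S] [IsNoetherian S]
    (hp : IsSemiStableCurve p) (hS : ∀ s : S, IsIntegrallyClosed (S.presheaf.stalk s))
    (hη : Smooth (p.fiberToSpecResidueField (genericPoint S))) [IsIntegral C] (c : C)
    {a y : C.presheaf.stalk c} (ha0 : a ≠ 0) (hy : y ∉ Ideal.span {a})
    (hmy : ∀ r ∈ maximalIdeal (C.presheaf.stalk c), r * y ∈ Ideal.span {a}) :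
    IsIntegrallyClosed (C.presheaf.stalk c) := by
  classical
  haveI := hp.flat
  haveI := hp.locallyOfFiniteType
  haveI : IsLocallyNoetherian C := LocallyOfFiniteType.isLocallyNoetherian p
  -- over the generic point: `R₁`
  by_cases hc : p c = genericPoint S
  · haveI := isRegularLocalRing_stalk_of_eq_genericPoint p hη hc
    exact isIntegrallyClosed_of_isRegularLocalRing _
  -- the flat local homomorphism `A = 𝒪_{S,p c} → B = 𝒪_{𝒞,c}`
  let A : Type u := S.presheaf.stalk (p c)
  let B : Type u := C.presheaf.stalk c
  letI : Algebra A B := (p.stalkMap c).hom.toAlgebra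
  haveI : IsLocalHom (algebraMap A B) := inferInstanceAs (IsLocalHom (p.stalkMap c).hom)
  haveI : Module.Flat A B := Flat.stalkMap p c
  have hmA : maximalIdeal A ≠ ⊥ := maximalIdeal_stalk_ne_bot_of_ne_genericPoint hc
  obtain ⟨a₁, ha₁m, ha₁0⟩ := (Submodule.ne_bot_iff _).mp hmA
  have ha₁reg : IsSMulRegular A a₁ := (IsRegular.of_ne_zero ha₁0).left.isSMulRegular
  have ha₁B : algebraMap A B a₁ ∈ maximalIdeal B := map_nonunit (algebraMap A B) a₁ ha₁m
  have ha₁B0 : algebraMap A B a₁ ≠ 0 := by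
    intro h0
    have hreg : IsSMulRegular B (algebraMap A B a₁) := ha₁reg.of_flat
    rw [h0] at hreg
    have h10 : (1 : B) = 0 := hreg (by simp)
    exact one_ne_zero h10
  obtain ⟨z, hz, hmz⟩ := depthOne_transfer (maximalIdeal B) ha0 ha₁B0 ha₁B hy hmy
  -- the fibre ring `F = B/𝔪_A B` is reduced
  have hFred : IsReduced (B ⧸ (maximalIdeal A).map (algebraMap A B)) := isReduced_fibreRing hp c
  by_cases hF : IsField (B ⧸ (maximalIdeal A).map (algebraMap A B))
  · -- `F` a field: the witness descends to `A`, which is then regular, and so is `B`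
    have hmz' : ∀ t ∈ maximalIdeal A, algebraMap A B t * z ∈ Ideal.span {algebraMap A B a₁} :=
      fun t ht => hmz _ (map_nonunit (algebraMap A B) t ht)
    obtain ⟨w, hw, hmw⟩ := exists_depthOne_witness_base ha₁reg hz hmz'
    haveI : IsRegularLocalRing A := isRegularLocalRing_of_depthOne_witness (hS (p c)) ha₁0 hw hmw
    haveI := IsRegularLocalRing.of_flat_of_isField_quotient hF
    exact isIntegrallyClosed_of_isRegularLocalRing B
  · -- `F` not a field: some `t ∈ 𝔪_B` is `F`-regular, hence `B/a₁B`-regular — absurd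
    exfalso
    have hne : (maximalIdeal A).map (algebraMap A B) ≠ ⊤ := by
      intro htop
      apply (IsLocalRing.maximalIdeal.isMaximal B).ne_top
      exact top_le_iff.mp (htop ▸ (Ideal.map_le_iff_le_comap.mpr fun t ht =>
        map_nonunit (algebraMap A B) t ht))
    haveI : Nontrivial (B ⧸ (maximalIdeal A).map (algebraMap A B)) :=
      Ideal.Quotient.nontrivial_iff.mpr hne
    haveI : IsLocalRing (B ⧸ (maximalIdeal A).map (algebraMap A B)) :=
      IsLocalRing.of_surjective' (Ideal.Quotient.mk _) Ideal.Quotient.mk_surjective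
    obtain ⟨t', ht'm, ht'reg⟩ := exists_mem_maximalIdeal_isSMulRegular hF
    obtain ⟨t, rfl⟩ := Ideal.Quotient.mk_surjective t'
    have htm : t ∈ maximalIdeal B := by
      intro htu
      exact ht'm (htu.map (Ideal.Quotient.mk _))
    have htreg : IsSMulRegular (B ⧸ (maximalIdeal A).map (algebraMap A B)) t := by
      refine isSMulRegular_iff_right_eq_zero_of_smul.mpr fun x hx => ?_
      refine ht'reg.right_eq_zero_of_smul ?_
      rwa [Algebra.smul_def, Ideal.Quotient.algebraMap_eq] at hx
    have hjac : (maximalIdeal A).map (algebraMap A B) ≤ Ideal.jacobson ⊥ := by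
      refine le_trans ?_ (IsLocalRing.maximalIdeal_le_jacobson ⊥)
      rw [Ideal.map_le_iff_le_comap]
      intro r hr
      exact map_nonunit (algebraMap A B) r hr
    have key := Matsumura1987.isSMulRegular_quotient_map hjac htreg (Ideal.span {a₁})
    rw [Ideal.map_span, Set.image_singleton, Matsumura1987.isSMulRegular_quotient_iff] at key
    exact hz (key z (hmz t htm))

end DeJong1996SemiStableCurveNormalProof

open DeJong1996SemiStableCurveNormalProof in
/-- **de Jong 1996, 4.21 — THE DISCHARGE of `DeJong1996SemiStableCurveNormal`: a semi-stable
curve `𝒞 → S` over an integral Noetherian normal scheme with smooth generic fibre is a normal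
scheme.** "We remark that `𝒞` is a normal scheme: it is flat over a normal excellent scheme,
with reduced fibres of dimension 1, hence condition S₂ is fullfilled; the smooth locus of
`𝒞 → S` is dense in all fibres and the generic fibre is smooth, hence `𝒞` is regular in
codimension 1; apply the criterium of Serre (S₂ + R₁ ⇒ normal)." Proof here (Serre's criterion
not being available): `𝒞` is integral (Liu 4.3.8); if `b/a ∈ K(𝒞)` is integral over
`B = 𝒪_{𝒞,c}` with `b ∉ aB`, an associated prime `P ⊇ (aB : b)` of `B/aB` is the prime of a
generization `c'` of `c`, and `𝒪_{𝒞,c'} = B_P` has depth one, hence is integrally closed by the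
key lemma (`isIntegrallyClosed_stalk_of_depthOne_witness`: `R₁` over the generic point,
Matsumura's Cor. to 22.5 and 23.7 with the normality of `S` elsewhere); so `b/a ∈ B_P`, i.e.
`ub ∈ aB` for some `u ∉ P` — contradicting `(aB : b) ⊆ P`. [cite: DeJong1996, 4.21, p. 74] -/
theorem DeJong1996SemiStableCurveNormal_holds : DeJong1996SemiStableCurveNormal.{u} := by
  intro C S _ _ p hp hS hη c
  classical
  haveI := hp.flat
  haveI := hp.locallyOfFiniteType
  haveI : IsLocallyNoetherian C := LocallyOfFiniteType.isLocallyNoetherian p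
  haveI : IsIntegral C := isIntegral_of_isSemiStableCurve hp hη
  let B : Type u := C.presheaf.stalk c
  change IsIntegrallyClosed B
  rw [isIntegrallyClosed_iff (FractionRing B)]
  intro x hx
  obtain ⟨b, a, ha, rfl⟩ := IsFractionRing.div_surjective (A := B) x
  have ha0 : a ≠ 0 := nonZeroDivisors.ne_zero ha
  have haK : algebraMap B (FractionRing B) a ≠ 0 :=
    IsFractionRing.to_map_ne_zero_of_mem_nonZeroDivisors ha
  suffices hdvd : b ∈ Ideal.span {a} by
    obtain ⟨w, hw⟩ := Ideal.mem_span_singleton'.mp hdvd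
    refine ⟨w, ?_⟩
    rw [← hw, map_mul, mul_div_cancel_right₀ _ haK]
  by_contra hb
  -- an associated prime `P ⊇ (aB : b)` of `B/aB`, `P = (aB : y)`
  have hb0 : Ideal.Quotient.mk (Ideal.span {a}) b ≠ 0 := by
    rwa [Ne, Ideal.Quotient.eq_zero_iff_mem]
  obtain ⟨P, hP, hbP⟩ := exists_le_isAssociatedPrime_of_isNoetherianRing B _ hb0
  rw [isAssociatedPrime_iff] at hP
  obtain ⟨hPprime, ybar, hPy⟩ := hP
  obtain ⟨y, rfl⟩ := Ideal.Quotient.mk_surjective ybar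
  have hsmul : ∀ r s : B, r • Ideal.Quotient.mk (Ideal.span {a}) s = 0 ↔ r * s ∈ Ideal.span {a} :=
    fun r s => by
      rw [Algebra.smul_def, Ideal.Quotient.algebraMap_eq, ← map_mul, Ideal.Quotient.eq_zero_iff_mem]
  have hmemP : ∀ r : B, r ∈ P ↔ r * y ∈ Ideal.span {a} := fun r => by
    rw [hPy, Submodule.mem_colon_singleton, Submodule.mem_bot, hsmul]
  have hbP' : ∀ r : B, r * b ∈ Ideal.span {a} → r ∈ P := fun r hr =>
    hbP (by rw [Submodule.mem_colon_singleton, Submodule.mem_bot, hsmul]; exact hr)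
  -- the generization `c'` of `c` with `𝒪_{𝒞,c'} = B_P`
  haveI := hPprime
  obtain ⟨c', hc', hPeq⟩ := exists_specializes_comap_stalkSpecializes_eq c P
  subst hPeq
  let B' : Type u := C.presheaf.stalk c'
  letI : Algebra B B' := (C.presheaf.stalkSpecializes hc').hom.toAlgebra
  haveI hloc : IsLocalization.AtPrime B'
      ((maximalIdeal (C.presheaf.stalk c')).comap (C.presheaf.stalkSpecializes hc').hom) :=
    isLocalizationAtPrime_stalkSpecializes (X := C) hc'
  set P := (maximalIdeal (C.presheaf.stalk c')).comap (C.presheaf.stalkSpecializes hc').hom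
    with hPdef
  have h0P : (0 : B) ∉ P.primeCompl := fun h => h (Submodule.zero_mem P)
  have hinj : Function.Injective (algebraMap B B') :=
    IsLocalization.injective B' (le_nonZeroDivisors_of_noZeroDivisors h0P)
  let φ := algebraMap B B'
  have ha' : φ a ≠ 0 := fun h => ha0 (hinj (by rw [h, map_zero]))
  have hmk : ∀ (d : B) (u : P.primeCompl) (r : B),
      IsLocalization.mk' B' d u * φ r = φ (d * r) * IsLocalization.mk' B' 1 u := fun d u r => by
    rw [IsLocalization.mk'_eq_mul_mk'_one, map_mul]
    ring
  have hclear : ∀ (d : B) (u : P.primeCompl) (r s : B),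
      IsLocalization.mk' B' d u * φ r = φ s → d * r = u * s := fun d u r s h => by
    apply hinj
    rw [hmk] at h
    calc φ (d * r) = φ (d * r) * (φ (u : B) * IsLocalization.mk' B' 1 u) := by
          rw [IsLocalization.mk'_spec', map_one, mul_one]
      _ = φ (u : B) * (φ (d * r) * IsLocalization.mk' B' 1 u) := by ring
      _ = φ ((u : B) * s) := by rw [h, map_mul]
  -- `𝒪_{𝒞,c'}` has depth one: the witness `(φ a, φ y)`
  have hy' : φ y ∉ Ideal.span {φ a} := by
    intro h
    obtain ⟨w, hw⟩ := Ideal.mem_span_singleton'.mp h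
    obtain ⟨d, u, rfl⟩ := IsLocalization.exists_mk'_eq P.primeCompl w
    have h2 : d * a = u * y := hclear d u a y hw
    exact u.2 ((hmemP u).mpr (Ideal.mem_span_singleton'.mpr ⟨d, h2⟩))
  have hmy' : ∀ r' ∈ maximalIdeal B', r' * φ y ∈ Ideal.span {φ a} := by
    intro r' hr'
    obtain ⟨r, u, rfl⟩ := IsLocalization.exists_mk'_eq P.primeCompl r'
    have hrP : r ∈ P := by
      by_contra hrP
      exact hr' ((IsLocalization.AtPrime.isUnit_mk'_iff B' P r u).mpr hrP)
    obtain ⟨e, he⟩ := Ideal.mem_span_singleton'.mp ((hmemP r).mp hrP)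
    refine Ideal.mem_span_singleton'.mpr ⟨φ e * IsLocalization.mk' B' 1 u, ?_⟩
    calc φ e * IsLocalization.mk' B' 1 u * φ a = φ (e * a) * IsLocalization.mk' B' 1 u := by
          rw [map_mul]; ring
      _ = φ (r * y) * IsLocalization.mk' B' 1 u := by rw [he]
      _ = IsLocalization.mk' B' r u * φ y := (hmk r u y).symm
  have hIC : IsIntegrallyClosed B' :=
    isIntegrallyClosed_stalk_of_depthOne_witness hp hS hη c' ha' hy' hmy'
  -- transport `b/a` to `K(𝒪_{𝒞,c'})`: it lies in `B_P`
  let K := FractionRing B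
  let K' := FractionRing B'
  have hunits : ∀ s : nonZeroDivisors B,
      IsUnit (((algebraMap B' K').comp φ) s) := fun s => by
    rw [RingHom.comp_apply]
    refine IsUnit.mk0 _ fun h => nonZeroDivisors.ne_zero s.2 (hinj ?_)
    rw [map_zero]
    exact (map_eq_zero_iff _ (IsFractionRing.injective B' K')).mp h
  let ψ : K →+* K' := IsLocalization.lift (M := nonZeroDivisors B) hunits
  have hψ : ∀ r : B, ψ (algebraMap B K r) = algebraMap B' K' (φ r) := fun r =>
    IsLocalization.lift_eq hunits r
  have hint : IsIntegral B' (ψ (algebraMap B K b / algebraMap B K a)) :=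
    hx.map_of_comp_eq φ ψ (by ext r; simp [hψ])
  rw [map_div₀, hψ, hψ] at hint
  haveI := hIC
  obtain ⟨v, hv⟩ := IsIntegrallyClosed.algebraMap_eq_of_integral hint
  have ha'K : algebraMap B' K' (φ a) ≠ 0 :=
    fun h => ha' ((map_eq_zero_iff _ (IsFractionRing.injective B' K')).mp h)
  have hva : v * φ a = φ b := by
    apply IsFractionRing.injective B' K'
    rw [map_mul, hv, div_mul_cancel₀ _ ha'K]
  -- `v = d/u`, so `ub ∈ aB` with `u ∉ P`: contradiction
  obtain ⟨d, u, rfl⟩ := IsLocalization.exists_mk'_eq P.primeCompl v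
  have h4 : d * a = u * b := hclear d u a b hva
  exact u.2 (hbP' u (Ideal.mem_span_singleton'.mpr ⟨d, h4⟩))


end Literature.AlgebraicGeometry.Resolution

end
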